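import Mathlib
import HarnessLib
import Summits.CriticalPhenomena.Ising3DConformalLimit.Theorems.BernsteinTemperaturePlanarPressureAMExtract
import Summits.CriticalPhenomena.Ising3DConformalLimit.Theorems.BernsteinTemperaturePlanarPressureAMOnsager
import Summits.CriticalPhenomena.Ising3DConformalLimit.Theses.BernsteinTemperature

/-!
# Route BernsteinTemperature, item `PlanarPressureAM`: Onsager's pressure is absolutely monotone
in `tanh β` on `[0, β_c(2))`

Settles item `stmt-CriticalPhenomena-10768` (support, route
`route-CriticalPhenomena-BernsteinTemperature`), exact signature: `PlanarPressureAM`.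

Proof. With `v = tanh β`, `w = v²` one has `cosh 2β = (1+w)/(1-w)`, `sinh 2β = 2v/(1-w)` and
Onsager's high-temperature modulus `κ² = 4 sinh² 2β / cosh⁴ 2β = 16w(1-w)²/(1+w)⁴ =: x(w)`.
File D2 evaluates the double integral: `ψ(β) = log 2 + log cosh 2β - Φ(κ²)/4`,
`Φ(z) = ∑_{n≥1} cₙ zⁿ/n`, `cₙ = ((2n choose n)/4ⁿ)²` (so `Φ' = (₂F₁(½,½;1;·) - 1)/z`, the complete
elliptic integral `K`). Files C/E/F show that `R(w) = log((1+w)/(1-w)) - Φ(x(w))/4` has a Taylor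
series at `0` with non-negative coefficients converging on `[0, 3-2√2) = [0, tanh² β_c)`: the
coefficients are governed by the order-five P-recurrence of the pulled-back hypergeometric
equation, whose solution has the two-sided ratio bounds of file A (`λ = 3+2√2 = 1/tanh² β_c`),
giving the sign `6 yₘ₊₁ ≥ yₘ₊₂ + yₘ` and hence `rₘ ≥ 0`. Finally `aₙ = r_{n/2}` (`n` even, `a₀ =
log 2`), `aₙ = 0` (`n` odd).
-/

namespace Summit.CriticalPhenomena.Ising3DConformalLimit.Theorems

open Real Finset intervalIntegral MeasureTheory
open scoped Topology
open Summit.CriticalPhenomena.Ising3DConformalLimit.Theses.BernsteinTemperature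

/-- The route item `PlanarPressureAM` (Onsager's pressure is absolutely monotone in `tanh β` on
`[0, β_c(2))`). [folklore] -/
theorem planarPressureAM_proof : PlanarPressureAM := by
  -- the elliptic coefficient sequence
  have hle := planarPressureAM_c_abs_le
  have hc0 : (fun n : ℕ => (Nat.centralBinom n : ℝ) ^ 2 / 16 ^ n) 0 = 1 := by
    simp [Nat.centralBinom_zero]
  have hratio := planarPressureAM_c_succ
  obtain ⟨r, hr_nonneg, hr⟩ := planarPressureAM_R_series
    (fun n : ℕ => (Nat.centralBinom n : ℝ) ^ 2 / 16 ^ n) hle hc0 hratio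
  have hs2pos : (0 : ℝ) < 3 - 2 * Real.sqrt 2 := by
    have : Real.sqrt 2 < (1.5 : ℝ) := by
      rw [Real.sqrt_lt' (by norm_num)]; norm_num
    linarith
  -- `r 0 = 0`
  have hr0 : r 0 = 0 := by
    have h := hr 0 le_rfl hs2pos
    have e : (fun n : ℕ => r n * (0 : ℝ) ^ n) = fun n => if n = 0 then r 0 else 0 := by
      funext n; rcases n with _ | n <;> simp
    rw [e] at h
    have h2 := (hasSum_ite_eq 0 (r 0)).unique h
    rw [h2]
    have ht : ∑' n : ℕ, (Nat.centralBinom n : ℝ) ^ 2 / 16 ^ n / (n : ℝ) * (0 : ℝ) ^ n = 0 := by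
      rw [tsum_eq_single 0 (fun n hn => by simp [hn])]
      simp
    have hx0 : (16 * (0 : ℝ) * (1 - 0) ^ 2 / (1 + 0) ^ 4) = 0 := by norm_num
    rw [hx0, ht]
    simp
  -- the coefficient sequence in powers of `tanh β`
  refine ⟨fun n => if Even n then (if n = 0 then Real.log 2 else r (n / 2)) else 0, ?_, ?_⟩
  · intro n
    dsimp only
    split_ifs
    · exact Real.log_nonneg (by norm_num)
    · exact hr_nonneg _
    · exact le_rfl
  intro β hβ hβc
  -- `sinh 2β < 1`
  have hs1 : Real.sinh (2 * β) < 1 := by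
    have h2β : 2 * β < Real.arsinh 1 := by
      rw [Real.arsinh]
      have : (1 : ℝ) + Real.sqrt (1 + 1 ^ 2) = 1 + Real.sqrt 2 := by norm_num
      rw [this]
      linarith
    have := Real.sinh_lt_sinh.2 h2β
    rwa [Real.sinh_arsinh] at this
  have hI := planarPressureAM_onsager_integral hβ hs1
  -- `v = tanh β`, `w = v²`
  set v : ℝ := Real.tanh β with hv_def
  set ch : ℝ := Real.cosh β with hch_def
  set sh : ℝ := Real.sinh β with hsh_def
  have hch : 0 < ch := Real.cosh_pos _
  have hsh : 0 ≤ sh := by rw [hsh_def, Real.sinh_nonneg_iff]; exact hβ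
  have hv : v = sh / ch := by rw [hv_def, Real.tanh_eq_sinh_div_cosh]
  have hone : ch ^ 2 - sh ^ 2 = 1 := Real.cosh_sq_sub_sinh_sq β
  have hv0 : 0 ≤ v := by rw [hv]; positivity
  have hv1 : v < 1 := Real.tanh_lt_one β
  have hw1 : 0 < 1 - v ^ 2 := by nlinarith
  have hC : Real.cosh (2 * β) = (1 + v ^ 2) / (1 - v ^ 2) := by
    rw [Real.cosh_two_mul, hv]
    rw [← hch_def, ← hsh_def]
    field_simp
    nlinarith [hone]
  have hS : Real.sinh (2 * β) = 2 * v / (1 - v ^ 2) := by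
    rw [Real.sinh_two_mul, hv]
    rw [← hch_def, ← hsh_def]
    field_simp
    nlinarith [hone]
  -- `w < 3 - 2√2`
  have hsq : Real.sqrt 2 ^ 2 = 2 := Real.sq_sqrt (by norm_num)
  have hwc : v ^ 2 < 3 - 2 * Real.sqrt 2 := by
    have h1 : 2 * v < 1 - v ^ 2 := by
      have := hs1
      rw [hS, div_lt_one hw1] at this
      exact this
    have h2 : v + 1 < Real.sqrt 2 := by
      rw [Real.lt_sqrt (by linarith)]
      nlinarith
    have h3 : v < Real.sqrt 2 - 1 := by linarith
    have h4 : v ^ 2 < (Real.sqrt 2 - 1) ^ 2 := by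
      exact pow_lt_pow_left₀ h3 hv0 two_ne_zero
    nlinarith
  -- the modulus
  have hx : 4 * Real.sinh (2 * β) ^ 2 / Real.cosh (2 * β) ^ 4
      = 16 * v ^ 2 * (1 - v ^ 2) ^ 2 / (1 + v ^ 2) ^ 4 := by
    rw [hS, hC]
    have : (1 + v ^ 2) ≠ 0 := by positivity
    field_simp
    ring
  have hR := hr (v ^ 2) (sq_nonneg v) hwc
  -- even and odd parts
  have he : HasSum (fun k : ℕ => (fun n => (if Even n then (if n = 0 then Real.log 2 else r (n / 2))
      else 0) * Real.tanh β ^ n) (2 * k))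
      (Real.log ((1 + v ^ 2) / (1 - v ^ 2)) - 1 / 4 * ∑' n : ℕ,
          (Nat.centralBinom n : ℝ) ^ 2 / 16 ^ n / (n : ℝ)
            * (16 * v ^ 2 * (1 - v ^ 2) ^ 2 / (1 + v ^ 2) ^ 4) ^ n + Real.log 2) := by
    have h2 : HasSum (fun k : ℕ => (if k = 0 then Real.log 2 else 0)) (Real.log 2) :=
      hasSum_ite_eq 0 _
    refine (hR.add h2).congr_fun fun k => ?_
    simp only [even_two_mul, if_true, Nat.mul_eq_zero, OfNat.ofNat_ne_zero, false_or,
      Nat.mul_div_cancel_left k two_pos, ← hv_def, pow_mul]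
    by_cases hk : k = 0
    · subst hk; simp [hr0]
    · simp [hk]
  have ho : HasSum (fun k : ℕ => (fun n => (if Even n then (if n = 0 then Real.log 2 else r (n / 2))
      else 0) * Real.tanh β ^ n) (2 * k + 1)) 0 := by
    have : (fun k : ℕ => (fun n => (if Even n then (if n = 0 then Real.log 2 else r (n / 2))
        else 0) * Real.tanh β ^ n) (2 * k + 1)) = fun _ => 0 := by
      funext k
      simp [Nat.not_even_iff_odd.2 (odd_two_mul_add_one k)]
    rw [this]; exact hasSum_zero
  have hsum := HasSum.even_add_odd
    (f := fun n => (if Even n then (if n = 0 then Real.log 2 else r (n / 2)) else 0) * Real.tanh β ^ n)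
    he ho
  convert hsum using 1
  rw [hI, hx, hC]
  have hπ : (Real.pi : ℝ) ≠ 0 := Real.pi_ne_zero
  field_simp
  ring

end Summit.CriticalPhenomena.Ising3DConformalLimit.Theorems
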